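import Summits.CriticalPhenomena.Ising3D.Control2DCellSpin
import Summits.CriticalPhenomena.Ising3D.Control2DCellScheme2
import Mathlib.Tactic.NormNum
import HarnessLib

/-!
# The 2D control: the SECOND-ORDER kernel checker for obligation (C) and its soundness
(cell `pub-ising3x`, seat controls-1; evaluates `Control2DCellScheme2.lean`; data and point
evaluation from `Control2DCellCheck.lean`)

HONEST FRAMING: lottery ticket; floor = tightest certified 3D Ising CFT bounds; no exact-solution
claim without a proof.

Same data (`CDat`, `mkCData`) and point enclosures (`pointC`: `f_d(t) = (xy)^{t/2}`,
`b_d(t) = brR N ℓ t x y`) as the first-order checker; per cell `[t₀, t₁]` with right stencil `t₂` and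
left stencil `t₋` (the previous cut point, or a pre-point below the first cell, or none), the three
integer lower bounds `A, B, C` of the quadratic minorant of `Control2DCellScheme2.quadLB` (`sums6`: all
products of NON-NEGATIVE intervals, differences by `NI.subT` of ordered pairs, divisions/multiplications
by the dyadic widths exact up to rounding) and the exact test `quadOK` of `quad_nonneg_on`;
`checkSpin2` runs a cut list. Soundness: `sums6_spec`, `quadOK_sound`, `checkSpin2_sound`,
`cellPositive_of_checkSpin2`. All PROVED; the kernel evaluations are in the certificate run files.
-/

namespace Summit.CriticalPhenomena.Ising3D.Control2D

open Set Finset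
open Literature.MathematicalPhysics.QuantumFieldTheory.ConformalBootstrap3D

/-! ### Dyadic widths -/

/-- Numerator of a non-negative dyadic rational. [folklore] -/
def dyNum (q : ℚ) : ℕ := q.num.toNat

/-- Binary exponent of the denominator of a dyadic rational. [folklore] -/
def dyExp (q : ℚ) : ℕ := Nat.log2 q.den

/-- `I / H` for a positive dyadic `H = n / 2^r`: multiply by `2^r`, divide by `n`. [folklore] -/
def divDy (I : NI) (H : ℚ) : NI := (I.mulNat (2 ^ dyExp H)).divNat (dyNum H)

/-- `I · H` for a non-negative dyadic `H = n / 2^r`. [folklore] -/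
def mulDy (I : NI) (H : ℚ) : NI := (I.mulNat (dyNum H)).divNat (2 ^ dyExp H)

/-! ### The cell sums and the quadratic test -/

/-- The three integer lower bounds `(A, B, C)` (scale `2^P`) of the quadratic minorant on a cell with
widths `H0 = t₀ - t₋`, `H = t₁ - t₀`, `H3 = t₂ - t₁`, from the point enclosures at `t₋, t₀, t₁, t₂`
(`useD0 = false`: no left stencil, slope `0`). [folklore] -/
def sums6 (P : ℕ) (useD0 : Bool) (H0 H H3 : ℚ) :
    List CDat → List (NI × NI) → List (NI × NI) → List (NI × NI) → List (NI × NI) → ℤ × ℤ × ℤ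
  | d :: ds, qm :: rm, q0 :: r0, q1 :: r1, q2 :: r2 =>
    let acc := sums6 P useD0 H0 H H3 ds rm r0 r1 r2
    let c := d.cabs
    if d.pos then
      let D3 := divDy (q1.1.subT q2.1) H3
      let a0 := q1.1.add (mulDy D3 H)
      let D0 := if useD0 then divDy (q0.2.subT qm.2) H0 else NI.zero
      (acc.1 + ((((c.mul P a0).mul P q0.2).lo : ℕ) : ℤ),
        acc.2.1 + ((((c.mul P a0).mul P D0).lo : ℕ) : ℤ) - ((((c.mul P D3).mul P q0.2).hi : ℕ) : ℤ),
        acc.2.2 - ((((c.mul P D3).mul P D0).hi : ℕ) : ℤ))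
    else
      let D1 := divDy (q0.1.subT q1.1) H
      let U := divDy (q1.2.subT q0.2) H
      (acc.1 - ((((c.mul P q0.1).mul P q0.2).hi : ℕ) : ℤ),
        acc.2.1 - ((((c.mul P q0.1).mul P U).hi : ℕ) : ℤ) + ((((c.mul P D1).mul P q0.2).lo : ℕ) : ℤ),
        acc.2.2 + ((((c.mul P D1).mul P U).lo : ℕ) : ℤ))
  | _, _, _, _, _ => (0, 0, 0)

/-- The exact minimum test of `A + Bτ + Cτ² ≥ 0` on `[0, H]`, `H = n/2^r`, in integers. [folklore] -/
def quadOK (S : ℤ × ℤ × ℤ) (H : ℚ) : Bool :=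
  let n : ℤ := ((dyNum H : ℕ) : ℤ)
  let p : ℤ := ((2 ^ dyExp H : ℕ) : ℤ)
  decide (0 ≤ S.1) && decide (0 ≤ S.1 * (p * p) + S.2.1 * n * p + S.2.2 * (n * n)) &&
    (decide (S.2.2 ≤ 0) || decide (0 ≤ S.2.1) || decide (S.2.1 * p + 2 * S.2.2 * n ≤ 0) ||
      decide (S.2.1 * S.2.1 ≤ 4 * S.1 * S.2.2))

/-- **The second-order spin checker.** Cut list `T`, extra right stencil, a pre-point `pre` used as the
left stencil of the first cell when `usePre` (for `ℓ = 0`; for `ℓ ≥ 2` the first cell takes slope `0`),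
later cells use the previous cut point. [folklore] -/
def checkSpin2 (P N ℓ : ℕ) (vni : List NI) (cds : List CDat) (usePre : Bool) (pre : ℚ) (T : List ℚ)
    (extra : ℚ) : Bool :=
  let Tx := T ++ [extra]
  let PT := Tx.map (pointC P N ℓ vni cds)
  let PM := pointC P N ℓ vni cds pre
  (Tx.all fun t => dyOK t && decide ((ℓ : ℚ) ≤ t)) &&
  (!usePre || (dyOK pre && decide ((ℓ : ℚ) ≤ pre) && decide (pre < T.getD 0 0))) &&
  allBelow (fun k => decide (Tx.getD k 0 < Tx.getD (k + 1) 0)) T.length &&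
  allBelow (fun k =>
    quadOK (sums6 P (if k = 0 then usePre else true)
        (if k = 0 then T.getD 0 0 - pre else Tx.getD k 0 - Tx.getD (k - 1) 0)
        (Tx.getD (k + 1) 0 - Tx.getD k 0) (Tx.getD (k + 2) 0 - Tx.getD (k + 1) 0) cds
        (if k = 0 then PM else PT.getD (k - 1) []) (PT.getD k []) (PT.getD (k + 1) []) (PT.getD (k + 2) []))
      (Tx.getD (k + 1) 0 - Tx.getD k 0)) (T.length - 1)

end Summit.CriticalPhenomena.Ising3D.Control2D
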